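import Summits.Ventures.LatticeQCDFlow.Scaling.TwoLevelRegimeFreeDoeblin
import Summits.Ventures.LatticeQCDFlow.Scaling.DominatedStarRegimeFreeTimeAverages

/-!
HONEST FRAMING: exact (Metropolis-corrected) sampling algorithms for lattice gauge theory; figures
of merit are autocorrelation/cost numbers at stated couplings and volumes; no continuum-physics
claim.

# TwoLevelRegimeFreeSampleSize — ONE COLD LEVEL: THE HONEST SAMPLE SIZE FROM EVERY START WITH NOTHING OF THE VOLUME IN IT —
# BURN-IN `r ≥ 3⌈log(2/ε)/(t((1−t)w_0)²p)⌉`, RUN `N ≥ (4Var_π̃(f)/(η²ε))/(p·min{ct/(3m), (1−t)w_0/7})` ⇒ `P_x{|N⁻¹Σ_{s<N} f(X_{r+s}) − E_π̃ f| ≥ η} ≤ ε`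
# (lean-2 GEN-28, ours)

Venture-side (OURS).  Cell `lqcd-flow` (pub-lqcd), unit `pub-lqcd-lean-2-g28`, 2026-08-28.  Chapter N, file 20: `Scaling/TwoLevelRegimeFreeDoeblin`
(N18: the volume-free burn-in for `K = 1`) combined with `Scaling/DominatedStarRegimeFreeGap` (N2: `Gap ≥ p·min{ct/(3m), (1−t)w_0/(7K)}`, here `K = 1`)
in Levin–Peres–Wilmer's Theorem 12.21 (typed in `Literature/Probability/MarkovChains/TimeAverageConcentration`).  For the two-level map-assisted
exchange with exact hot redraws NEITHER the burn-in NOR the run length involves `|S|`, `μ_min` or a regime condition: OPEN-MATH-chapterM item 1 in its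
practical form, for one cold level.

## What is proved

* **`twoLevel_timeAverage`** — `m ≥ 1` entries on the edge `(0,1)` (`≥ c ≥ 1` of them, trivially all), maps with `p·μ_1(φ_r u) ≤ μ_0(u)`, `0 < p ≤ 1`,
  exact hot redraws, `μ_k`-reversible kernels, `0 < t < 1`, `w ≥ 0`, `Σw = 1`, `w_0 > 0`: from EVERY start `x`, with burn-in
  `r ≥ 3·⌈log(2/ε)/(t((1−t)w_0)²p)⌉` and run length `N ≥ 1`, `N ≥ (4Var_π̃(f)/(η²ε))·(1/(p·min{ct/(3m), (1−t)w_0/7}))`, the time average of any `f`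
  over the run deviates from `E_π̃ f` by `≥ η` with probability `≤ ε`.
* **`twoLevel_halfSwap_timeAverage`** — at `t = ½`, `w_0 = 1`: burn-in `r ≥ 3⌈(8/p)·log(2/ε)⌉`, run `N ≥ (4Var_π̃(f)/(η²ε))·(14/p)`.

Reading (no numerics implied): for one cold level the whole honest-sampling recipe is volume-free — `O(p⁻¹·log(1/ε))` steps of burn-in and
`O(Var/(p·η²ε))` steps of averaging.  NOT CLAIMED: `K ≥ 2` (the burn-in of `Scaling/DominatedStarVolumeFreeDoeblin` is volume-free but exponential
in `K`; the practical `K`-level recipe keeps the `log(1/π̃_min)` or `log log` burn-in of `Scaling/HalfSwapStarRecipe`); anything measured.  Literature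
grade (cell rule): OWN COMPOSITION on N2/N8/N18 and the typed [LevinPeres2017, Thm 12.21]; nothing new cited as a fact; no new bib keys.
-/

noncomputable section

open Finset Function Matrix
open Literature.Probability.MarkovChains

namespace Summit.Ventures.LatticeQCDFlow.Scaling

variable {S : Type*} [Fintype S] [DecidableEq S] {m : ℕ} {μ : Fin (1 + 1) → S → ℝ} {M : Fin (1 + 1) → S → S → ℝ}
  {w : Fin (1 + 1) → ℝ} {t p : ℝ}

section TwoLevel
variable (κ : Fin m → Fin 1) (φ : Fin m → Equiv.Perm S)

/-- **THE VOLUME-FREE HONEST SAMPLE SIZE FROM EVERY START, ONE COLD LEVEL:** burn-in `r ≥ 3⌈log(2/ε)/(t((1−t)w_0)²p)⌉`, run `N ≥ 1` with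
`N ≥ (4Var_π̃(f)/(η²ε))/(p·min{ct/(3m), (1−t)w_0/7})` ⇒ `P_x{|N⁻¹Σ_{s<N} f(X_{r+s}) − E_π̃ f| ≥ η} ≤ ε`. [ours] -/
theorem twoLevel_timeAverage [Nontrivial S] (hm : 1 ≤ m) (ht0 : 0 < t) (ht1 : t < 1) (hw0 : ∀ k, 0 ≤ w k) (hw00 : 0 < w 0)
    (hw1 : ∑ k, w k = 1) (hμ : ∀ k x, 0 < μ k x) (hμ1 : ∀ k, ∑ u, μ k u = 1) (hM : ∀ k, IsRowStochastic (M k))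
    (hMrev : ∀ k, DetailedBalance (μ k) (M k)) (hM0 : ∀ u v, M 0 u v = μ 0 v) (hp0 : 0 < p) (hp1 : p ≤ 1)
    (hdom : ∀ r u, p * μ (κ r).succ (φ r u) ≤ μ 0 u)
    {c : ℕ} (hc1 : 1 ≤ c) (hc : ∀ p' : Fin 1, c ≤ (univ.filter (fun r : Fin m => κ r = p')).card)
    (f : (Fin (1 + 1) → S) → ℝ) {ε η : ℝ} (hε : 0 < ε) (hη : 0 < η) {r N : ℕ}
    (hr : 3 * ⌈Real.log (2 / ε) / (t * ((1 - t) * w 0) ^ 2 * p)⌉₊ ≤ r) (hN : 0 < N)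
    (hNvar : 4 * lawVariance (tensorFun μ) f / (η ^ 2 * ε) * (1 / (p * min (c * t / (3 * m)) ((1 - t) * w 0 / 7))) ≤ N)
    (x : Fin (1 + 1) → S) :
    pathSum (fun y z : Fin (1 + 1) → S =>
        t * ptGraphSwap μ (fun r : Fin m => (((0 : Fin (1 + 1)), (κ r).succ) : Fin (1 + 1) × Fin (1 + 1))) φ y z
          + (1 - t) * prodKernel w M y z) (N + r) x (fun ω =>
        if η ≤ |(∑ s : Fin N, f ((Matrix.vecCons x ω : Fin (N + r + 1) → (Fin (1 + 1) → S))
              ⟨(s : ℕ) + r, by have := s.isLt; omega⟩)) / N - lawMean (tensorFun μ) f|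
          then (1 : ℝ) else 0) ≤ ε := by
  have hmpos : (0 : ℝ) < m := Nat.cast_pos.mpr (by omega)
  have hcpos : (0 : ℝ) < c := Nat.cast_pos.mpr (by omega)
  have h1t : 0 < 1 - t := by linarith
  have hP := weightedScheme_isRowStochastic (t := t) (w := w)
    (ptGraphSwap_isRowStochastic (e := fun r : Fin m => (((0 : Fin (1 + 1)), (κ r).succ) : Fin (1 + 1) × Fin (1 + 1)))
      (φ := φ) hμ) hM hw0 hw1 ht0.le ht1.le
  have hDB := weightedScheme_detailedBalance (w := w)
    (ptGraphSwap_detailedBalance (e := fun r : Fin m => (((0 : Fin (1 + 1)), (κ r).succ) : Fin (1 + 1) × Fin (1 + 1)))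
      (φ := φ) hμ) hMrev t
  have hirr := dominatedStar_isIrreducible_regimeFree κ φ ht0 ht1 hw0 hw00 hw1 hμ hM hM0 hc1 hc
  have hε2 : 0 < ε / 2 := by linarith
  -- a witness that `d(·) ≤ ε/2` is attained (the spectral burn-in of N8, `K = 1`), and N18's volume-free bound on `t_mix(ε/2)`
  have ht₀ := dominatedStar_worstTvDist_le_regimeFree κ φ le_rfl hm ht0 ht1 hw0 hw00 hw1 hμ hμ1 hM hMrev hM0 hp0 hp1 hdom hc1 hc
    (πmin := univ.inf' univ_nonempty (tensorFun μ)) (by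
      obtain ⟨z, _, hz⟩ := exists_mem_eq_inf' univ_nonempty (tensorFun μ)
      rw [hz]; exact tensorFun_pos hμ z) (fun z => inf'_le _ (mem_univ z)) hε2 (Nat.le_ceil _)
  have hS : Nonempty S := inferInstance
  have hmix : mixingTime (fun y z : Fin (1 + 1) → S =>
      t * ptGraphSwap μ (fun r : Fin m => (((0 : Fin (1 + 1)), (κ r).succ) : Fin (1 + 1) × Fin (1 + 1))) φ y z
        + (1 - t) * prodKernel w M y z) (tensorFun μ) (ε / 2) ≤ r := by
    have h := twoLevel_mixingTime_le κ φ hm hμ hμ1 hM hMrev hM0 hw0 hw1 hw00 ht0 ht1 hp0 hdom hε2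
    rw [one_div_div] at h
    exact h.trans hr
  -- the run length through `Gap ≥ p·min{ct/(3m), (1−t)w_0/7}`
  have hgap := dominatedStar_spectralGap_ge_regimeFree κ φ le_rfl hm ht0 ht1 hw0 hw00 hw1 hμ hμ1 hM hMrev hM0 hp0 hp1 hdom hc1 hc
  have h7 : ((1 - t) * w 0 / (7 * ((1 : ℕ) : ℝ))) = (1 - t) * w 0 / 7 := by rw [Nat.cast_one, mul_one]
  rw [h7] at hgap
  have hGpos : 0 < p * min (c * t / (3 * m)) ((1 - t) * w 0 / 7) := mul_pos hp0 (lt_min (by positivity) (by positivity))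
  have hγinv : (spectralGap (tensorFun μ) (fun y z : Fin (1 + 1) → S =>
      t * ptGraphSwap μ (fun r : Fin m => (((0 : Fin (1 + 1)), (κ r).succ) : Fin (1 + 1) × Fin (1 + 1))) φ y z
        + (1 - t) * prodKernel w M y z))⁻¹ ≤ 1 / (p * min (c * t / (3 * m)) ((1 - t) * w 0 / 7)) := by
    rw [← one_div]; exact one_div_le_one_div_of_le hGpos hgap
  have hV : 0 ≤ 4 * lawVariance (tensorFun μ) f / (η ^ 2 * ε) :=
    div_nonneg (mul_nonneg (by norm_num) (lawVariance_nonneg (fun z => (tensorFun_pos hμ z).le) f)) (by positivity)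
  exact LevinPeres2017_thm_12_21 (fun z => tensorFun_pos hμ z) (sum_tensorFun_eq_one _ hμ1) hP hDB hirr f hε hη ht₀ hmix hN
    ((mul_le_mul_of_nonneg_left hγinv hV).trans hNvar) x

/-- **THE HALF-SWAP TWO-LEVEL RECIPE (`t = ½`, `w_0 = 1`):** burn-in `r ≥ 3⌈(8/p)·log(2/ε)⌉`, run `N ≥ 1` with `N ≥ (4Var_π̃(f)/(η²ε))·(14/p)` ⇒
deviation probability `≤ ε` from every start — nothing of the volume anywhere. [ours] -/
theorem twoLevel_halfSwap_timeAverage [Nontrivial S] (hm : 1 ≤ m) (hw0 : ∀ k, 0 ≤ w k) (hw01 : w 0 = 1) (hw1 : ∑ k, w k = 1)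
    (hμ : ∀ k x, 0 < μ k x) (hμ1 : ∀ k, ∑ u, μ k u = 1) (hM : ∀ k, IsRowStochastic (M k))
    (hMrev : ∀ k, DetailedBalance (μ k) (M k)) (hM0 : ∀ u v, M 0 u v = μ 0 v) (hp0 : 0 < p) (hp1 : p ≤ 1)
    (hdom : ∀ r u, p * μ (κ r).succ (φ r u) ≤ μ 0 u)
    (f : (Fin (1 + 1) → S) → ℝ) {ε η : ℝ} (hε : 0 < ε) (hη : 0 < η) {r N : ℕ}
    (hr : 3 * ⌈8 / p * Real.log (2 / ε)⌉₊ ≤ r) (hN : 0 < N)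
    (hNvar : 4 * lawVariance (tensorFun μ) f / (η ^ 2 * ε) * (14 / p) ≤ N) (x : Fin (1 + 1) → S) :
    pathSum (fun y z : Fin (1 + 1) → S =>
        (1 / 2 : ℝ) * ptGraphSwap μ (fun r : Fin m => (((0 : Fin (1 + 1)), (κ r).succ) : Fin (1 + 1) × Fin (1 + 1))) φ y z
          + (1 - 1 / 2) * prodKernel w M y z) (N + r) x (fun ω =>
        if η ≤ |(∑ s : Fin N, f ((Matrix.vecCons x ω : Fin (N + r + 1) → (Fin (1 + 1) → S))
              ⟨(s : ℕ) + r, by have := s.isLt; omega⟩)) / N - lawMean (tensorFun μ) f|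
          then (1 : ℝ) else 0) ≤ ε := by
  have hmpos : (0 : ℝ) < m := Nat.cast_pos.mpr (by omega)
  -- every entry is on the edge `(0,1)`: multiplicity `c = m`
  have hc : ∀ p' : Fin 1, m ≤ (univ.filter (fun r : Fin m => κ r = p')).card := fun p' => by
    rw [filter_true_of_mem (fun r _ => Subsingleton.elim _ _), card_univ, Fintype.card_fin]
  have hδ : (1 / 2 : ℝ) * ((1 - 1 / 2) * w 0) ^ 2 * p = p / 8 := by rw [hw01]; ring
  have hr' : 3 * ⌈Real.log (2 / ε) / ((1 / 2 : ℝ) * ((1 - 1 / 2) * w 0) ^ 2 * p)⌉₊ ≤ r := by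
    rw [hδ]
    have : Real.log (2 / ε) / (p / 8) = 8 / p * Real.log (2 / ε) := by field_simp
    rw [this]
    exact hr
  have hmin : 1 / (p * min (m * (1 / 2 : ℝ) / (3 * m)) ((1 - 1 / 2) * w 0 / 7)) = 14 / p := by
    rw [hw01]
    have h6 : (m : ℝ) * (1 / 2) / (3 * m) = 1 / 6 := by field_simp; ring
    rw [h6, min_eq_right (by norm_num), mul_one]
    field_simp
    ring
  have hNvar' : 4 * lawVariance (tensorFun μ) f / (η ^ 2 * ε)
      * (1 / (p * min (m * (1 / 2 : ℝ) / (3 * m)) ((1 - 1 / 2) * w 0 / 7))) ≤ N := by rw [hmin]; exact hNvar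
  exact twoLevel_timeAverage κ φ hm (by norm_num) (by norm_num) hw0 (by rw [hw01]; exact one_pos) hw1 hμ hμ1 hM hMrev hM0 hp0 hp1
    hdom hm hc f hε hη hr' hN hNvar' x

end TwoLevel

end Summit.Ventures.LatticeQCDFlow.Scaling

end
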